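import Summits.PneNP.PneNP.Theses.EquivariantThetaLift
import Literature.Combinatorics.Optimization.EquivariantPsdStructure
import HarnessLib

/-!
# Route `EquivariantThetaLift`, item `EquivariantStructureSq`: closed by the FSP structure theorem

The route item `Summit.PneNP.PneNP.Theses.EquivariantThetaLift.EquivariantStructureSq` (an
`S_n`-equivariant psd factorization of size `d` of the perfect-matching slack matrix yields an
`S_n`-invariant subspace `V` of matching functions with `dim V ≤ d²` in which every odd-cut slack is a
finite sum of squares — Fawzi–Saunderson–Parrilo 2013, Thm. 1/4 at factorization level) is PROVED in
the tree as `Literature.Combinatorics.Optimization.EquivariantPsdStructure.equivariantStructureSq`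
(`Literature/Combinatorics/Optimization/EquivariantPsdStructure.lean`: Weyl-averaged Gram matrix,
orthogonalised representation, equivariant psd square roots). Nothing is re-proved here (D-0059).
-/

set_option linter.dupNamespace false -- `Summit.PneNP.PneNP.…`: summit = sub-problem (D-0017)

namespace Summit.PneNP.PneNP.Theorems

/-- **Item `EquivariantStructureSq` of route `EquivariantThetaLift`** — by the tree theorem
`Literature.Combinatorics.Optimization.EquivariantPsdStructure.equivariantStructureSq`.
[cite: FawziSaundersonParrilo2013, Thm. 1] -/
theorem EquivariantStructureSq_proof :
    Summit.PneNP.PneNP.Theses.EquivariantThetaLift.EquivariantStructureSq :=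
  Literature.Combinatorics.Optimization.EquivariantPsdStructure.equivariantStructureSq

end Summit.PneNP.PneNP.Theorems
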